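import Literature.AlgebraicGeometry.KTheory.PullbackVectorBundle
import Literature.AlgebraicGeometry.Modules.FiniteType
import Mathlib.AlgebraicGeometry.Morphisms.ClosedImmersion

/-!
# Sections of the unit `N ⟶ i_* i^* N` for a finite locally free `N` (support file for EB1)

Support lemmas for stub EB1 (`stub_towerPresentation`) of line `chow-zariski-pushforward` of the crux
`FormalVectorBundlesAlgebraize` (route `PadicSemiregularLift` of `HodgeConjecture`).

Mathlib's inverse image `Scheme.Modules.pullback i` of sheaves of modules is an abstract left adjoint
(`Functor.leftAdjoint` of the direct image), so its sections are not computable by unfolding. For a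
morphism of schemes `i : X ⟶ Y` and a FINITE LOCALLY FREE `𝒪_Y`-module `N` we nevertheless prove the
two facts about the unit `η_N : N ⟶ i_* i^* N` of `Scheme.Modules.pullbackPushforwardAdjunction i` that
the `p`-adic ladders of EB1 need, on every affine open `V` inside a trivialising open of `N`:

* if `i` is a closed immersion, `η_N` is surjective on sections over `V`;
* a section `x ∈ Γ(N, V)` is killed by `η_N` iff `x ∈ ker(i♯ : Γ(Y, V) → Γ(X, i⁻¹V)) · Γ(N, V)`.

Proof: both properties hold for the unit module (`η_𝒪` followed by the isomorphism
`i_*(i^*𝒪_Y ≅ 𝒪_X)` of Mathlib's `pullbackObjUnitToUnit` is `i♯`), hence for finite direct sums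
`𝒪_Y^I`; a local trivialisation of `N` on `U` yields morphisms `𝒪_Y^I ⟶ j_* (N|_U) ⟵ N` (`j : U ↪ Y`)
which are isomorphisms over `U`, and so are their images under `i^*` over `i⁻¹U` (pseudofunctoriality of
pull-back along `i⁻¹U ↪ X ⟶ Y = i⁻¹U ⟶ U ↪ Y`, tree `nonempty_pullbackRestrictIso`); naturality of the
unit transports the two properties to `N`. Everything is proved; no definitions.
-/

noncomputable section

-- Summit.HodgeConjecture.HodgeConjecture.… repeats the summit name by the D-0017 layout (Sub = Summit).
set_option linter.dupNamespace false
-- `(𝟭 _).obj M` / `(F ⋙ G).obj M` are unfolded by the category-theory lemmas used below (as in Mathlib's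
-- `AlgebraicGeometry/Modules/Sheaf.lean`).
set_option backward.isDefEq.respectTransparency false

open CategoryTheory CategoryTheory.Limits AlgebraicGeometry TopologicalSpace Opposite
open Literature.AlgebraicGeometry.Motives Literature.AlgebraicGeometry.KTheory

universe u

namespace Summit.HodgeConjecture.HodgeConjecture.Theorems.FormalVectorBundlesAlgebraize

variable {X Y : Scheme.{u}}

/-! ### Section-level bookkeeping -/

/-- Finite sums of morphisms act on sections termwise. -/
theorem sum_app_apply {M N : Y.Modules} {κ : Type*} (s : Finset κ) (φ : κ → (M ⟶ N))
    (V : Y.Opens) (x : Γ(M, V)) :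
    (∑ k ∈ s, φ k).app V x = ∑ k ∈ s, (φ k).app V x := by
  classical
  induction s using Finset.induction_on with
  | empty => rw [Finset.sum_empty, Finset.sum_empty, Scheme.Modules.Hom.zero_app]; rfl
  | insert a s ha ih =>
    rw [Finset.sum_insert ha, Finset.sum_insert ha, Scheme.Modules.Hom.add_app, ← ih]
    rfl

/-- Composites act on sections by composition. -/
theorem comp_app_apply' {M N K : Y.Modules} (φ : M ⟶ N) (ψ : N ⟶ K) (V : Y.Opens) (x : Γ(M, V)) :
    (φ ≫ ψ).app V x = ψ.app V (φ.app V x) := rfl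

/-- Restriction along equal opens is bijective. -/
theorem map_bijective_of_eq (M : Y.Modules) {V W : Y.Opens} (h : W ≤ V) (h' : W = V) :
    Function.Bijective (M.presheaf.map (homOfLE h).op) := by
  subst h'
  rw [show homOfLE h = 𝟙 W from Subsingleton.elim _ _, op_id, M.presheaf.map_id]
  exact Function.bijective_id

/-! ### Restriction to opens: isomorphisms over `U` are bijective on the opens inside `U` -/

/-- If `f|_U` (restriction along the open immersion `U ↪ Y`) is an isomorphism, then `f` is bijective
on the sections over every open `W ≤ U`. -/
theorem app_bijective_of_isIso_restrict (U : Y.Opens) {M N : Y.Modules} (f : M ⟶ N)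
    [IsIso ((Scheme.Modules.restrictFunctor U.ι).map f)] {W : Y.Opens} (hW : W ≤ U) :
    Function.Bijective (f.app W) := by
  have hW' : U.ι ''ᵁ (U.ι ⁻¹ᵁ W) = W := by
    rw [Scheme.Hom.image_preimage_eq_opensRange_inf, Scheme.Opens.opensRange_ι, inf_eq_right.mpr hW]
  have h : IsIso (f.app (U.ι ''ᵁ (U.ι ⁻¹ᵁ W))) :=
    (inferInstance : IsIso (((Scheme.Modules.restrictFunctor U.ι).map f).app (U.ι ⁻¹ᵁ W)))
  rw [hW'] at h
  exact ConcreteCategory.bijective_of_isIso (f.app W)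

/-- The unit `M ⟶ j_* (M|_U)` of Mathlib's `restrictAdjunction` becomes an isomorphism after restriction
to `U` (triangle identity; the counit is an isomorphism). -/
theorem isIso_restrict_map_restrictAdjunction_unit (U : Y.Opens) (M : Y.Modules) :
    IsIso ((Scheme.Modules.restrictFunctor U.ι).map
      ((Scheme.Modules.restrictAdjunction U.ι).unit.app M)) := by
  have h := (Scheme.Modules.restrictAdjunction U.ι).left_triangle_components M
  exact IsIso.of_isIso_fac_right h

/-- **Isomorphisms over `U` pull back to isomorphisms over `i⁻¹U`**: if `f|_U` is an isomorphism then
so is `(i^* f)|_{i⁻¹U}` (`(i⁻¹U ↪ X)^* i^* ≅ (i ∣_ U)^* (U ↪ Y)^*`, tree `nonempty_pullbackRestrictIso`,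
and Mathlib's `restrictFunctorIsoPullback`). -/
theorem isIso_restrict_pullback_map (i : X ⟶ Y) (U : Y.Opens) {M N : Y.Modules} (f : M ⟶ N)
    [IsIso ((Scheme.Modules.restrictFunctor U.ι).map f)] :
    IsIso ((Scheme.Modules.restrictFunctor (i ⁻¹ᵁ U).ι).map ((Scheme.Modules.pullback i).map f)) := by
  obtain ⟨e⟩ := nonempty_pullbackRestrictIso i U
  have h1 : IsIso ((Scheme.Modules.pullback U.ι).map f) :=
    (NatIso.isIso_map_iff (Scheme.Modules.restrictFunctorIsoPullback U.ι) f).mp inferInstance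
  have h2 : IsIso ((Scheme.Modules.pullback U.ι ⋙ Scheme.Modules.pullback (i ∣_ U)).map f) :=
    (inferInstance : IsIso ((Scheme.Modules.pullback (i ∣_ U)).map
      ((Scheme.Modules.pullback U.ι).map f)))
  have h3 : IsIso ((Scheme.Modules.pullback i ⋙ Scheme.Modules.pullback (i ⁻¹ᵁ U).ι).map f) :=
    (NatIso.isIso_map_iff e f).mpr h2
  exact (NatIso.isIso_map_iff (Scheme.Modules.restrictFunctorIsoPullback (i ⁻¹ᵁ U).ι)
    ((Scheme.Modules.pullback i).map f)).mpr h3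

/-! ### The unit on the structure sheaf and on its finite direct sums -/

section Unit

variable (i : X ⟶ Y)

/-- Mathlib's comparison `i^* 𝒪_Y ⟶ 𝒪_X` is an isomorphism (the functor `U ↦ i⁻¹U` is final, tree
`final_opensMap`), retyped in the category `X.Modules`. -/
theorem isIso_pullbackObjUnitToUnit :
    IsIso (show ((Scheme.Modules.pullback i).obj (SheafOfModules.unit Y.ringCatSheaf) : X.Modules) ⟶
        (SheafOfModules.unit X.ringCatSheaf : X.Modules) from
      SheafOfModules.pullbackObjUnitToUnit i.toRingCatSheafHom) := by
  haveI := final_opensMap i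
  exact (inferInstance : IsIso (SheafOfModules.pullbackObjUnitToUnit i.toRingCatSheafHom))

/-- `η_𝒪` followed by `i_*(i^* 𝒪_Y ⟶ 𝒪_X)` (Mathlib `pullbackObjUnitToUnit`) is `i♯` on sections. -/
theorem unit_app_unit_apply (V : Y.Opens) (a : Γ(Y, V)) :
    (((Scheme.Modules.pushforward i).map
        (SheafOfModules.pullbackObjUnitToUnit i.toRingCatSheafHom)).app V
      (((Scheme.Modules.pullbackPushforwardAdjunction i).unit.app
        (SheafOfModules.unit Y.ringCatSheaf)).app V a) : Γ(X, i ⁻¹ᵁ V)) = i.app V a := by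
  have h : (Scheme.Modules.pullbackPushforwardAdjunction i).unit.app
      (SheafOfModules.unit Y.ringCatSheaf) ≫ (Scheme.Modules.pushforward i).map
        (SheafOfModules.pullbackObjUnitToUnit i.toRingCatSheafHom) =
      SheafOfModules.unitToPushforwardObjUnit i.toRingCatSheafHom := by
    rw [← SheafOfModules.pullbackPushforwardAdjunction_homEquiv_pullbackObjUnitToUnit,
      Adjunction.homEquiv_unit]
    rfl
  calc _ = ((Scheme.Modules.pullbackPushforwardAdjunction i).unit.app
        (SheafOfModules.unit Y.ringCatSheaf) ≫ (Scheme.Modules.pushforward i).map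
          (SheafOfModules.pullbackObjUnitToUnit i.toRingCatSheafHom)).app V a := rfl
    _ = i.app V a := by rw [h]; rfl

/-- The sections of `i_* i^* M` over `V` form a `Γ(Y, V)`-module on which `ker i♯` acts trivially. -/
theorem smul_pushforward_pullback_eq_zero {M : X.Modules} (V : Y.Opens) {c : Γ(Y, V)}
    (hc : i.app V c = 0) (z : Γ((Scheme.Modules.pushforward i).obj M, V)) : c • z = 0 := by
  change i.app V c • (show Γ(M, i ⁻¹ᵁ V) from z) = 0
  rw [hc, zero_smul]

/-- The unit kills `ker i♯ · Γ(N, V)` (for every `𝒪_Y`-module `N`). -/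
theorem unit_app_eq_zero_of_mem_smul_top (N : Y.Modules) (V : Y.Opens) (x : Γ(N, V))
    (hx : x ∈ RingHom.ker (i.app V).hom • (⊤ : Submodule Γ(Y, V) Γ(N, V))) :
    ((Scheme.Modules.pullbackPushforwardAdjunction i).unit.app N).app V x = 0 := by
  refine Submodule.smul_induction_on hx (fun c hc n _ => ?_) (fun x y hx hy => ?_)
  · rw [Scheme.Modules.Hom.app_smul]
    exact smul_pushforward_pullback_eq_zero i V hc _
  · rw [map_add, hx, hy, add_zero]

variable [IsClosedImmersion i]

/-- For a closed immersion `i` and an affine open `V`, `η_𝒪` is surjective on sections over `V`. -/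
theorem unit_app_unit_surjective {V : Y.Opens} (hV : IsAffineOpen V) :
    Function.Surjective (((Scheme.Modules.pullbackPushforwardAdjunction i).unit.app
      (SheafOfModules.unit Y.ringCatSheaf)).app V) := by
  intro z
  let θ := (Scheme.Modules.pushforward i).map
    (SheafOfModules.pullbackObjUnitToUnit i.toRingCatSheafHom)
  haveI hθ : IsIso θ := by
    haveI := isIso_pullbackObjUnitToUnit i
    exact Functor.map_isIso (Scheme.Modules.pushforward i) _
  obtain ⟨a, ha⟩ := i.app_surjective V hV (θ.app V z)
  refine ⟨a, ?_⟩
  have hinj : Function.Injective (θ.app V) :=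
    (ConcreteCategory.bijective_of_isIso (θ.app V)).1
  apply hinj
  rw [← ha]
  exact unit_app_unit_apply i V a

omit [IsClosedImmersion i] in
/-- `η_𝒪 a = 0` iff `i♯ a = 0`. -/
theorem unit_app_unit_eq_zero_iff {V : Y.Opens} (a : Γ(Y, V)) :
    ((Scheme.Modules.pullbackPushforwardAdjunction i).unit.app
      (SheafOfModules.unit Y.ringCatSheaf)).app V a = 0 ↔ i.app V a = 0 := by
  let θ := (Scheme.Modules.pushforward i).map
    (SheafOfModules.pullbackObjUnitToUnit i.toRingCatSheafHom)
  haveI hθ : IsIso θ := by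
    haveI := isIso_pullbackObjUnitToUnit i
    exact Functor.map_isIso (Scheme.Modules.pushforward i) _
  have hinj : Function.Injective (θ.app V) :=
    (ConcreteCategory.bijective_of_isIso (θ.app V)).1
  have key : θ.app V (((Scheme.Modules.pullbackPushforwardAdjunction i).unit.app
      (SheafOfModules.unit Y.ringCatSheaf)).app V a) = i.app V a := unit_app_unit_apply i V a
  constructor
  · intro h
    rw [← key, h, map_zero]
  · intro h
    apply hinj
    rw [key, h, map_zero]

end Unit

/-! ### Finite direct sums of the unit module -/

section Biproduct

variable {I : Type u} [Fintype I]

/-- `∑_k π_k ≫ ι_k = 𝟙` for a finite biproduct (Mathlib's `biproduct.total`, whose index type is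
restricted to `Type`). -/
theorem biproduct_total {J : Type*} [Fintype J] (M : J → Y.Modules) [HasBiproduct M] :
    ∑ k, biproduct.π M k ≫ biproduct.ι M k = 𝟙 (⨁ M) := by
  classical
  refine biproduct.hom_ext _ _ fun j => ?_
  rw [Preadditive.sum_comp, Category.id_comp, Finset.sum_eq_single j]
  · rw [Category.assoc, biproduct.ι_π_self, Category.comp_id]
  · intro k _ hkj
    rw [Category.assoc, biproduct.ι_π_ne _ hkj, comp_zero]
  · intro h
    exact absurd (Finset.mem_univ j) h

/-- Sections of a finite direct sum decompose along `biproduct.ι`, `biproduct.π`, after applying an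
additive functor `T` (such as `i_* i^*`). -/
theorem map_biproduct_decomposition (T : Y.Modules ⥤ Y.Modules) [T.Additive] (M : I → Y.Modules)
    [HasBiproduct M] (V : Y.Opens) (z : Γ(T.obj (⨁ M), V)) :
    z = ∑ k, (T.map (biproduct.ι M k)).app V ((T.map (biproduct.π M k)).app V z) := by
  have h1 : (T.map (𝟙 (⨁ M))).app V z = z := by
    rw [CategoryTheory.Functor.map_id]
    rfl
  conv_lhs => rw [← h1, ← biproduct_total M, Functor.map_sum, sum_app_apply]
  refine Finset.sum_congr rfl fun k _ => ?_
  rw [Functor.map_comp]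
  rfl

/-- Sections of a finite direct sum decompose along `biproduct.ι`, `biproduct.π`. -/
theorem biproduct_decomposition (M : I → Y.Modules) [HasBiproduct M] (V : Y.Opens) (x : Γ(⨁ M, V)) :
    x = ∑ k, (biproduct.ι M k).app V ((biproduct.π M k).app V x) := by
  have h1 : (𝟙 (⨁ M) : ⨁ M ⟶ ⨁ M).app V x = x := rfl
  conv_lhs => rw [← h1, ← biproduct_total M, sum_app_apply]
  rfl

/-- A section `c` of the unit module is `c • 1`. -/
theorem unit_section_eq_smul (V : Y.Opens)
    (c : Γ((SheafOfModules.unit Y.ringCatSheaf : Y.Modules), V)) :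
    ∃ (r : Γ(Y, V)) (u : Γ((SheafOfModules.unit Y.ringCatSheaf : Y.Modules), V)),
      r = c ∧ c = r • u := by
  refine ⟨c, (show Γ(Y, V) from 1), rfl, ?_⟩
  exact (mul_one (show Γ(Y, V) from c)).symm

/-- `η_{𝒪^I}` is surjective on affine opens for a closed immersion `i`. -/
theorem unit_app_biproduct_surjective (i : X ⟶ Y) [IsClosedImmersion i] (O : I → Y.Modules)
    [HasBiproduct O] (hO : ∀ k, O k = SheafOfModules.unit Y.ringCatSheaf) {V : Y.Opens}
    (hV : IsAffineOpen V) :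
    Function.Surjective (((Scheme.Modules.pullbackPushforwardAdjunction i).unit.app (⨁ O)).app V) := by
  let η := (Scheme.Modules.pullbackPushforwardAdjunction i).unit
  let T := Scheme.Modules.pullback i ⋙ Scheme.Modules.pushforward i
  have hsurj : ∀ k, Function.Surjective ((η.app (O k)).app V) := by
    intro k
    rw [hO k]
    exact unit_app_unit_surjective i hV
  intro z
  choose a ha using fun k => hsurj k ((T.map (biproduct.π O k)).app V z)
  refine ⟨∑ k, (biproduct.ι O k).app V (a k), ?_⟩
  rw [map_sum, map_biproduct_decomposition T O V z]
  refine Finset.sum_congr rfl fun k _ => ?_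
  rw [← ha k]
  exact congrArg (fun φ => Scheme.Modules.Hom.app φ V (a k)) (η.naturality (biproduct.ι O k))

/-- A section of `𝒪^I` killed by `η` lies in `ker i♯ · 𝒪^I`. -/
theorem mem_smul_top_of_unit_app_biproduct_eq_zero (i : X ⟶ Y) (O : I → Y.Modules) [HasBiproduct O]
    (hO : ∀ k, O k = SheafOfModules.unit Y.ringCatSheaf) (V : Y.Opens) (x : Γ(⨁ O, V))
    (hx : ((Scheme.Modules.pullbackPushforwardAdjunction i).unit.app (⨁ O)).app V x = 0) :
    x ∈ RingHom.ker (i.app V).hom • (⊤ : Submodule Γ(Y, V) Γ(⨁ O, V)) := by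
  let η := (Scheme.Modules.pullbackPushforwardAdjunction i).unit
  let T := Scheme.Modules.pullback i ⋙ Scheme.Modules.pushforward i
  -- the components of `x` are killed by `η_𝒪`, hence by `i♯`
  have hk : ∀ k, (η.app (O k)).app V ((biproduct.π O k).app V x) = 0 := by
    intro k
    have hnat := congrArg (fun φ => Scheme.Modules.Hom.app φ V x) (η.naturality (biproduct.π O k))
    change (η.app (O k)).app V ((biproduct.π O k).app V x) =
      (T.map (biproduct.π O k)).app V ((η.app (⨁ O)).app V x) at hnat
    rw [hnat, hx, map_zero]
  have key : ∀ (Q : Y.Modules) (_ : Q = SheafOfModules.unit Y.ringCatSheaf) (φ : Q ⟶ ⨁ O)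
      (c : Γ(Q, V)), (η.app Q).app V c = 0 →
        φ.app V c ∈ RingHom.ker (i.app V).hom • (⊤ : Submodule Γ(Y, V) Γ(⨁ O, V)) := by
    rintro Q rfl φ c hc
    rw [unit_app_unit_eq_zero_iff i] at hc
    obtain ⟨r, u, hr, hu⟩ := unit_section_eq_smul V c
    rw [hu, Scheme.Modules.Hom.app_smul]
    rw [← hr] at hc
    exact Submodule.smul_mem_smul hc Submodule.mem_top
  rw [biproduct_decomposition O V x]
  exact Submodule.sum_mem _ fun k _ => key (O k) (hO k) (biproduct.ι O k) _ (hk k)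

end Biproduct

/-! ### Transport to a finite locally free `N` -/

section Main

variable (i : X ⟶ Y) [IsClosedImmersion i] {N : Y.Modules}

/-- **Sections of the unit `N ⟶ i_* i^* N` for `N` finite locally free and `i` a closed immersion.**
Every point of `Y` has an open neighbourhood `U` such that for every affine open `V ≤ U`:
`η_N` is surjective on sections over `V`, and `η_N x = 0 ↔ x ∈ ker(i♯_V) · Γ(N, V)`. -/
theorem exists_nhds_unit_app_surjective_and_ker (hN : IsFiniteLocallyFree N) (y : Y) :
    ∃ U : Y.Opens, y ∈ U ∧ ∀ V : Y.Opens, IsAffineOpen V → V ≤ U →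
      Function.Surjective (((Scheme.Modules.pullbackPushforwardAdjunction i).unit.app N).app V) ∧
      ∀ x : Γ(N, V), ((Scheme.Modules.pullbackPushforwardAdjunction i).unit.app N).app V x = 0 ↔
        x ∈ RingHom.ker (i.app V).hom • (⊤ : Submodule Γ(Y, V) Γ(N, V)) := by
  classical
  -- finite biproducts in the abelian category `Y.Modules` (Mathlib keeps this a theorem)
  haveI : HasFiniteBiproducts Y.Modules := CategoryTheory.Abelian.hasFiniteBiproducts
  obtain ⟨U, hyU, I, hI, ⟨e⟩⟩ := hN.exists_free_iso_restrict y
  haveI := Fintype.ofFinite I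
  refine ⟨U, hyU, fun V hV hVU => ?_⟩
  -- the players: `O = 𝒪^I`, `P = j_* (N|_U)`, `b : N ⟶ P`, `a : 𝒪^I ⟶ P`
  obtain ⟨O, hO⟩ : ∃ O : I → Y.Modules, ∀ k, O k = SheafOfModules.unit Y.ringCatSheaf :=
    ⟨fun _ => SheafOfModules.unit Y.ringCatSheaf, fun _ => rfl⟩
  have hO' : O = fun _ => SheafOfModules.unit Y.ringCatSheaf := funext hO
  let η := (Scheme.Modules.pullbackPushforwardAdjunction i).unit
  let T := Scheme.Modules.pullback i ⋙ Scheme.Modules.pushforward i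
  let P : Y.Modules :=
    (Scheme.Modules.pushforward U.ι).obj ((Scheme.Modules.restrictFunctor U.ι).obj N)
  let b : N ⟶ P := (Scheme.Modules.restrictAdjunction U.ι).unit.app N
  obtain ⟨e₀⟩ := nonempty_pullbackFreeIso U.ι I
  let e₁ : SheafOfModules.free I ≅ (Scheme.Modules.restrictFunctor U.ι).obj (SheafOfModules.free I) :=
    (((Scheme.Modules.restrictFunctorIsoPullback U.ι).app _) ≪≫ e₀).symm
  let c : (⨁ O) ≅ (SheafOfModules.free I : Y.Modules) :=
    biproduct.isoCoproduct O ≪≫ eqToIso (by subst hO'; rfl)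
  let a : (⨁ O) ⟶ P := c.hom ≫ (Scheme.Modules.restrictAdjunction U.ι).unit.app _ ≫
    (Scheme.Modules.pushforward U.ι).map (e₁.inv ≫ e.hom)
  -- `a`, `b` are isomorphisms over `U`, and so are `i^* a`, `i^* b` over `i⁻¹U`
  haveI hbU : IsIso ((Scheme.Modules.restrictFunctor U.ι).map b) :=
    isIso_restrict_map_restrictAdjunction_unit U N
  haveI haU : IsIso ((Scheme.Modules.restrictFunctor U.ι).map a) := by
    haveI := isIso_restrict_map_restrictAdjunction_unit U (SheafOfModules.free I : Y.Modules)
    simp only [a, Functor.map_comp]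
    infer_instance
  haveI := isIso_restrict_pullback_map i U a
  haveI := isIso_restrict_pullback_map i U b
  have ha : Function.Bijective (a.app V) := app_bijective_of_isIso_restrict U a hVU
  have hb : Function.Bijective (b.app V) := app_bijective_of_isIso_restrict U b hVU
  have hTa : Function.Bijective ((T.map a).app V) :=
    app_bijective_of_isIso_restrict (i ⁻¹ᵁ U) ((Scheme.Modules.pullback i).map a)
      (show i ⁻¹ᵁ V ≤ i ⁻¹ᵁ U from fun _ hx => hVU hx)
  have hTb : Function.Bijective ((T.map b).app V) :=
    app_bijective_of_isIso_restrict (i ⁻¹ᵁ U) ((Scheme.Modules.pullback i).map b)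
      (show i ⁻¹ᵁ V ≤ i ⁻¹ᵁ U from fun _ hx => hVU hx)
  -- naturality of the unit, on sections
  have nat_a : ∀ w, (T.map a).app V ((η.app (⨁ O)).app V w) = (η.app P).app V (a.app V w) :=
    fun w => (congrArg (fun φ => Scheme.Modules.Hom.app φ V w) (η.naturality a)).symm
  have nat_b : ∀ x, (T.map b).app V ((η.app N).app V x) = (η.app P).app V (b.app V x) :=
    fun x => (congrArg (fun φ => Scheme.Modules.Hom.app φ V x) (η.naturality b)).symm
  refine ⟨fun z => ?_, fun x => ⟨fun hx => ?_, unit_app_eq_zero_of_mem_smul_top i N V x⟩⟩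
  · -- surjectivity
    obtain ⟨w, hw⟩ := hTa.2 ((T.map b).app V z)
    obtain ⟨x₀, rfl⟩ := unit_app_biproduct_surjective i O hO hV w
    obtain ⟨x, hx⟩ := hb.2 (a.app V x₀)
    refine ⟨x, hTb.1 ?_⟩
    rw [nat_b, hx, ← nat_a, hw]
  · -- kernel
    obtain ⟨x₀, hx₀⟩ := ha.2 (b.app V x)
    have h0 : (η.app (⨁ O)).app V x₀ = 0 := by
      apply hTa.1
      rw [nat_a, hx₀, ← nat_b, hx, map_zero, map_zero]
    have hmem := mem_smul_top_of_unit_app_biproduct_eq_zero i O hO V x₀ h0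
    -- the `Γ(Y, V)`-linear bijection `ψ = b⁻¹ ∘ a : Γ(𝒪^I, V) → Γ(N, V)` maps `x₀` to `x`
    let bL := LinearEquiv.ofBijective (Literature.AlgebraicGeometry.Modules.appLinear b V) hb
    let ψ := bL.symm.toLinearMap.comp (Literature.AlgebraicGeometry.Modules.appLinear a V)
    have hψ : ψ x₀ = x := by
      apply bL.injective
      change bL (bL.symm (a.app V x₀)) = b.app V x
      rw [LinearEquiv.apply_symm_apply, hx₀]
    rw [← hψ]
    have hle : (RingHom.ker (i.app V).hom • (⊤ : Submodule Γ(Y, V) Γ(⨁ O, V))).map ψ ≤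
        RingHom.ker (i.app V).hom • ⊤ := by
      rw [Submodule.map_smul'']
      exact Submodule.smul_mono le_rfl le_top
    exact hle (Submodule.mem_map_of_mem hmem)

end Main

/-- **Registered sub-goal** (helper stub of `stub_towerPresentation`, universe `0`): sections of the
unit `N ⟶ i_* i^* N` for `N` finite locally free and `i` a closed immersion
(`exists_nhds_unit_app_surjective_and_ker`). -/
theorem stub_pullbackUnitSections :
    ∀ (X Y : AlgebraicGeometry.Scheme.{0}) (i : X ⟶ Y) [AlgebraicGeometry.IsClosedImmersion i]
      (N : Y.Modules), Literature.AlgebraicGeometry.Motives.IsFiniteLocallyFree N → ∀ y : Y,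
      ∃ U : Y.Opens, y ∈ U ∧ ∀ V : Y.Opens, AlgebraicGeometry.IsAffineOpen V → V ≤ U →
        Function.Surjective
          (((AlgebraicGeometry.Scheme.Modules.pullbackPushforwardAdjunction i).unit.app N).app V) ∧
        ∀ x : Γ(N, V),
          ((AlgebraicGeometry.Scheme.Modules.pullbackPushforwardAdjunction i).unit.app N).app V x = 0 ↔
            x ∈ RingHom.ker (i.app V).hom • (⊤ : Submodule Γ(Y, V) Γ(N, V)) :=
  fun _ _ i _ _ hN y => exists_nhds_unit_app_surjective_and_ker i hN y

end Summit.HodgeConjecture.HodgeConjecture.Theorems.FormalVectorBundlesAlgebraize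

end
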